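import Mathlib
import Summits.ABC.IUTFork.Joshi.LogVolumesHulls
import HarnessLib

/-!
# [J-III] §5.3 — enlarging subsets of `B_E^{ℓ*}` by the `Aut(G_E)`-action, Frobenius stabilisation and closed
# convex hulls: Joshi's three set operators, typed generically, with their elementary properties proved

Block E (rung LADDER-ABC:A2.E) typing file of the abc-iut cell, seat abc-iut-E-t9, slot T-09 = K. Joshi, *Construction
of Arithmetic Teichmüller Spaces III*, arXiv:2401.13508v4 («Preliminary version for comments», unrefereed; bib
`Joshi2024ATS3`), **§5.3**, PDF pp. 40–42 of the cell's render `HOME/lit/renders/Joshi-arxiv-2401.13508/pNNNN.txt`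
(«p.N l.M» = line M of PDF page N). TAKES NO SIDE on [IUTchIII] Cor. 3.12, on Joshi's claims or on Mochizuki's report
on them; typed ≠ proved ≠ endorsed. §5.3 DEFINES three enlargements of a subset `S ⊂ B_E` (or of `B_E^{ℓ*}`); this file
has NO `Prop` hypothesis: every declaration is one of those definitions over a generic carrier, or a theorem that
FOLLOWS from it (the DERIVABLE rows of `HOME/plan/E/t9/INVENTORY.tsv`). Carriers are generic on purpose (INTERIM CARRIER
RULE, plan/E/ASSIGNMENTS.md §0.3): `M` is any type with an action of a group `G` (use: `M = B_E`, or `B_E^{ℓ*} =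
Fin l → B_E` with the diagonal action of `G = G_E`, Mathlib `Pi.mulAction`), `φ` any permutation of `M` (use: the
Frobenius of `B_E`, componentwise), and for convexity `M` is a topological module over a ring `O` (use: `O = 𝒪_E`, the
Fréchet topology of `B_E`). The rings themselves are typed in `Joshi/LocalPeriodRings.lean`. Imports: Mathlib and T-23's `LogVolumesHulls` (for `IsConvexNA`).

Source sentences (verbatim, own reading of the render) ↦ declarations:
* §5.3 p.40 l.40–46 «Given a subset `S` of the ring `B_E`, one can enlarge it in many natural ways … (the considerations
  of this paragraph will be applied with `E = E′_w` for each relevant `w ∈ 𝕍^{odd,ss}_p)`.»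
* **§5.3.1** p.40 l.47–p.41 l.15 «consider the natural action of `Aut(G_E)` on the data `G_E ↷ B_E` by pre-composing
  the action of `G_E` on `B_E` with `σ ∈ Aut(G_E)`. More precisely, if `σ ∈ Aut(G_E)` then consider the pre-composed or
  twisted action `G_E →^σ G_E ↷ B_E` (5.3.1.1) and let `S^σ` be the image of `S` under this new action of `G_E` on
  `B_E`. … if `S ⊂ B_E^{ℓ*}` is any subset then one simply takes the union `⋃_{σ ∈ Aut(G_E)} S^σ ⊂ B_E^{ℓ*}` (5.3.1.2).
  This provides a Galois enlargement of any subset.» ↦ `twistedAct` (5.3.1.1); `twistImage σ S` = `S^σ` in the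
  LITERAL reading R1 («image of `S` under the new action» := the set `⋃_g σ(g)·S` swept out by `S`); `autEnlargement`
  (5.3.1.2). The print does not say how an (outer) automorphism of `G_E` moves ELEMENTS of `B_E` (Rmk. 5.3.1.3 (1):
  `X_{F,E}` is not determined by `G_E`), so the parametrised reading R2 `enlargeBy Φ S := ⋃_i Φ i '' S` over an
  unspecified realisation `Φ` is typed beside it; R1 = R2 at `Φ (σ, g) := σ(g) • ·` (`autEnlargement_eq_enlargeBy`).
  KERNEL FACTS about R1, reported for the referee lanes, NOT an adjudication: `twistImage_eq_saturation` (for EVERY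
  `σ`, `S^σ = G_E·S`, as `σ` is a bijection of `G_E`), `autEnlargement_eq_saturation`, `autEnlargement_eq_self_of_stable`
  (on a `G_E`-stable set the literal enlargement adds nothing), `smul_autEnlargement` (the result is `G_E`-stable).
* Rmk. 5.3.1.3 p.41 l.16–25 (READING only) «(1) … the Fargues-Fontaine curve `X_{F,E}` is not uniquely identified by
  its étale fundamental group … (2) … taking unions over the images under automorphisms of `Aut(G_E)` is Mochizuki's
  way of applying the indeterminacy Ind1 in [Mochizuki, 2021c, Theorem 3.11] (my discussion of this is in § 8.11). (3)
  In this sense Mochizuki's indeterminacy Ind1 arises from the failure of the absolute Grothendieck conjecture for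
  Fargues-Fontaine curves». Dictionary row «`Aut(G_E)`-enlargement ↔ `Thm311.LogShells.Ind1Family`» = slot T-18.
* **§5.3.2** p.41 l.26–34 «replace `S ⊂ B_E` by `S ↦ ⋃_{n ∈ ℤ} φⁿ(S)` (5.3.2.1), where `φ` is the Frobenius morphism
  of `B_E`. This obviously applies to subsets of `B_E^{ℓ*}` and variants.» ↦ `frobEnlargement`; derived: `subset_`,
  `image_` (φ-stable), `_mono`, `_idem`, `_minimal` (smallest `φ`-stable superset), `image_frobEnlargement_of_comm`.
* **§5.3.3** p.41 l.35–39 «Finally one can replace such a Galois and Frobenius enlarged set `S` by the closure of its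
  convex hull `S` in `B_E` with respect to the Frechet topology i.e. one can replace `S` by the smallest, closed, convex
  subset containing `S` … (see [Schneider, 2002, Chapter I] or [Schikhof, 1984] for basic properties of convex sets in
  p-adic Banach spaces).» ↦ convexity REUSED from slot T-23 (`Summit.ABC.IUTFork.Joshi.LogVol.IsConvexNA`: empty, or an
  additive coset of an `𝒪`-submodule = of an «absolutely convex» set), `closedConvexHull O S` := ⋂ of the closed convex
  supersets;
  derived: contains `S`, closed, CONVEX (`isConvexNA_closedConvexHull`, so «the smallest closed convex subset containing
  `S`» exists), minimal, monotone, idempotent, `image_closedConvexHull` (commutes with `O`-linear homeomorphisms).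
* Rmk. 5.3.3.1 p.41 l.40–p.42 l.3 «… both about lower bounds and it is important to recognize that enlargements (i.e.
  adding elements to the set `S`) do not affect lower bounds on the supremum of norms of elements of `S`. On the other
  hand, on a suitably enlarged set, an upper bound may be relatively easier to obtain. This is the rationale for
  establishing [Mochizuki, 2021c, Corollary 3.12].» ↦ `lowerBound_biSup_mono`.
* The composite of p.41 l.35–36 (use site §6.7 pp.49–50, Thm. 6.7.1, slot T-11) ↦ `fullEnlargement` with
  `image_fullEnlargement` / `smul_fullEnlargement` (φ- and `G`-stability under the natural hypotheses), offered BY NAME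
  to T-11 — not a restatement of Thm. 6.7.1.
Nearest objects of OUR interface (analogues, nothing imported): `Summit.ABC.IUTFork.Thm311.LogShells.Ind1Family`
((Ind1) acting on packets), the REAL convex hull of regions in the `Cor312Hull*` files, E-t3's `thetaLocus` ([J-IIp]
Def. 8.3.1, a closure under Galois and Frobenius). bears_on: LADDER-ABC:A2.E.
-/

open scoped Pointwise
open Summit.ABC.IUTFork.Joshi.LogVol (IsConvexNA convexClosure)

namespace Summit.ABC.IUTFork.Joshi.ATS3
/-! ### §5.3.1 `Aut(G_E)`-enlargement (5.3.1.1)–(5.3.1.2) -/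
section AutEnlargement
variable {G : Type*} [Group G] {M : Type*} [MulAction G M]

/-- [J-III] (5.3.1.1), p.41 l.1–3: the **twisted (pre-composed) action** `G_E →^σ G_E ↷ B_E` of `g ∈ G` through
`σ ∈ Aut(G)`: `g` acts as `σ(g)`. A plain function, deliberately not an instance. [claim: Joshi2024ATS3, status: disputed] -/
def twistedAct (σ : MulAut G) (g : G) (m : M) : M := σ g • m

/-- [J-III] §5.3.1, p.41 l.4: **`S^σ`, «the image of `S` under this new action of `G_E` on `B_E`»**, in the literal
reading R1: the set swept out by `S` under the `σ`-twisted action, `⋃_g σ(g)·S`. [claim: Joshi2024ATS3, status: disputed] -/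
def twistImage (σ : MulAut G) (S : Set M) : Set M := ⋃ g : G, twistedAct σ g '' S

variable (G) in
/-- The `G`-saturation `G·S = ⋃_g g·S` of a subset (smallest `G`-stable superset). [folklore] -/
def saturation (S : Set M) : Set M := ⋃ g : G, g • S

variable (G) in
/-- [J-III] (5.3.1.2), p.41 l.8–15: the **Galois (`Aut(G_E)`-) enlargement** `⋃_{σ ∈ Aut(G_E)} S^σ` of a subset
`S ⊂ B_E^{ℓ*}` (reading R1 for `S^σ`). [claim: Joshi2024ATS3, status: disputed] -/
def autEnlargement (S : Set M) : Set M := ⋃ σ : MulAut G, twistImage σ S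

/-- `twistedAct σ g '' S = σ(g) • S`. [folklore] -/
theorem image_twistedAct (σ : MulAut G) (g : G) (S : Set M) : twistedAct σ g '' S = σ g • S := rfl

/-- `S ⊆ G·S`. [folklore] -/
theorem subset_saturation (S : Set M) : S ⊆ saturation G S := fun m hm =>
  Set.mem_iUnion.2 ⟨1, by simpa using hm⟩

/-- KERNEL FACT about reading R1: for EVERY `σ ∈ Aut(G)`, `S^σ = G·S` — an automorphism of `G` is a bijection, so the
twisted action sweeps out the same set as the original one. [folklore] -/
theorem twistImage_eq_saturation (σ : MulAut G) (S : Set M) : twistImage σ S = saturation G S := by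
  unfold twistImage saturation
  simp_rw [image_twistedAct]
  exact σ.surjective.iUnion_comp fun g : G => g • S

/-- Hence the literal `Aut(G_E)`-enlargement (5.3.1.2) IS the `G_E`-saturation. [folklore] -/
theorem autEnlargement_eq_saturation (S : Set M) : autEnlargement G S = saturation G S := by
  refine subset_antisymm (Set.iUnion_subset fun σ => (twistImage_eq_saturation σ S).le) ?_
  exact (twistImage_eq_saturation 1 S).ge.trans (Set.subset_iUnion (fun σ : MulAut G => twistImage σ S) 1)

/-- The enlargement contains `S` (the term `σ = id`, `g = 1`). [folklore] -/
theorem subset_autEnlargement (S : Set M) : S ⊆ autEnlargement G S :=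
  (subset_saturation S).trans (autEnlargement_eq_saturation S).ge

/-- `G·S` is `G`-stable. [folklore] -/
theorem smul_saturation (g : G) (S : Set M) : g • saturation G S = saturation G S := by
  unfold saturation
  rw [Set.smul_set_iUnion]
  simp_rw [smul_smul]
  exact (Group.mulLeft_bijective g).surjective.iUnion_comp fun h : G => h • S

/-- The `Aut(G_E)`-enlarged set is `G_E`-stable (Joshi's Thm. 6.7.1 (1) for this stage, slot T-11). [folklore] -/
theorem smul_autEnlargement (g : G) (S : Set M) : g • autEnlargement G S = autEnlargement G S := by
  rw [autEnlargement_eq_saturation, smul_saturation]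

/-- A `G`-stable set is its own saturation. [folklore] -/
theorem saturation_eq_self_of_stable {S : Set M} (h : ∀ g : G, g • S ⊆ S) : saturation G S = S :=
  subset_antisymm (Set.iUnion_subset h) (subset_saturation S)

/-- KERNEL FACT about reading R1: on a `G_E`-stable set the literal `Aut(G_E)`-enlargement adds nothing. (So under R1,
Thm. 6.7.1 (3) «`Aut(G_{E′_w})`-stable in the sense of earlier definitions» is automatic from (1).) [folklore] -/
theorem autEnlargement_eq_self_of_stable {S : Set M} (h : ∀ g : G, g • S ⊆ S) : autEnlargement G S = S := by
  rw [autEnlargement_eq_saturation, saturation_eq_self_of_stable h]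

/-- The enlargement is idempotent. [folklore] -/
theorem autEnlargement_idem (S : Set M) : autEnlargement G (autEnlargement G S) = autEnlargement G S :=
  autEnlargement_eq_self_of_stable fun g => (smul_autEnlargement g S).le

/-- The enlargement is monotone. [folklore] -/
theorem autEnlargement_mono {S T : Set M} (h : S ⊆ T) : autEnlargement G S ⊆ autEnlargement G T := by
  rw [autEnlargement_eq_saturation, autEnlargement_eq_saturation]
  exact Set.iUnion_mono fun g => Set.smul_set_mono h

/-- Reading R2 of §5.3.1 (parametrised): the enlargement of `S` by an arbitrary family `Φ` of self-maps of the carrier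
— how `Aut(G_E)` is realised on `B_E^{ℓ*}` is the datum `Φ` the print leaves implicit. [claim: Joshi2024ATS3, status: disputed] -/
def enlargeBy {ι : Type*} (Φ : ι → M → M) (S : Set M) : Set M := ⋃ i, Φ i '' S

/-- If the family contains the identity, the enlargement contains `S`. [folklore] -/
theorem subset_enlargeBy {ι : Type*} {Φ : ι → M → M} {i : ι} (h : Φ i = id) (S : Set M) : S ⊆ enlargeBy Φ S :=
  fun m hm => Set.mem_iUnion.2 ⟨i, by rw [h, Set.image_id]; exact hm⟩

/-- R1 is the instance of R2 with `Φ (σ, g) = σ(g) • ·`. [folklore] -/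
theorem autEnlargement_eq_enlargeBy (S : Set M) :
    autEnlargement G S = enlargeBy (fun (q : MulAut G × G) (m : M) => twistedAct q.1 q.2 m) S := by
  ext m
  simp only [autEnlargement, twistImage, enlargeBy, Set.mem_iUnion, Prod.exists]
end AutEnlargement

/-! ### §5.3.2 Frobenius stabilisation (5.3.2.1) -/
section FrobEnlargement
variable {M : Type*}

/-- [J-III] (5.3.2.1), p.41 l.26–34: the **Frobenius stabilisation enlargement** `S ↦ ⋃_{n ∈ ℤ} φⁿ(S)` of a subset,
for a permutation `φ` of the carrier (use: the Frobenius of `B_E`, an automorphism, acting componentwise on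
`B_E^{ℓ*}`). [claim: Joshi2024ATS3, status: disputed] -/
def frobEnlargement (φ : Equiv.Perm M) (S : Set M) : Set M := ⋃ n : ℤ, ⇑(φ ^ n) '' S

/-- The term `n = 0`: `S ⊆ ⋃ₙ φⁿ(S)`. [folklore] -/
theorem subset_frobEnlargement (φ : Equiv.Perm M) (S : Set M) : S ⊆ frobEnlargement φ S := fun m hm =>
  Set.mem_iUnion.2 ⟨0, by simpa using hm⟩

/-- The Frobenius enlargement is `φ`-stable: `φ(⋃ₙ φⁿ S) = ⋃ₙ φⁿ S` (shift `n ↦ n + 1`). [folklore] -/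
theorem image_frobEnlargement (φ : Equiv.Perm M) (S : Set M) : φ '' frobEnlargement φ S = frobEnlargement φ S := by
  unfold frobEnlargement
  rw [Set.image_iUnion]
  simp_rw [← Set.image_comp]
  have h : ∀ n : ℤ, (⇑φ ∘ ⇑(φ ^ n)) = ⇑(φ ^ (1 + n)) := fun n => by
    rw [zpow_one_add, Equiv.Perm.coe_mul]
  simp_rw [h]
  exact (Equiv.addLeft (1 : ℤ)).surjective.iUnion_comp fun n : ℤ => ⇑(φ ^ n) '' S

/-- … and `φ⁻¹`-stable. [folklore] -/
theorem symm_image_frobEnlargement (φ : Equiv.Perm M) (S : Set M) :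
    φ.symm '' frobEnlargement φ S = frobEnlargement φ S := by
  conv_lhs => rw [← image_frobEnlargement φ S]
  rw [← Set.image_comp, Equiv.symm_comp_self, Set.image_id]

/-- Monotone. [folklore] -/
theorem frobEnlargement_mono (φ : Equiv.Perm M) {S T : Set M} (h : S ⊆ T) :
    frobEnlargement φ S ⊆ frobEnlargement φ T :=
  Set.iUnion_mono fun _ => Set.image_mono h

/-- Minimality: a `φ`-stable superset `T` of `S` (`φ(T) = T`) contains the Frobenius enlargement — it is the smallest
`φ^{±1}`-stable subset containing `S`. [folklore] -/
theorem frobEnlargement_minimal (φ : Equiv.Perm M) {S T : Set M} (hST : S ⊆ T) (hT : φ '' T = T) :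
    frobEnlargement φ S ⊆ T := by
  have hmem : φ ∈ MulAction.stabilizer (Equiv.Perm M) T := hT
  refine Set.iUnion_subset fun n => (Set.image_mono hST).trans ?_
  have hn : φ ^ n ∈ MulAction.stabilizer (Equiv.Perm M) T := Subgroup.zpow_mem _ hmem n
  exact (MulAction.mem_stabilizer_iff.1 hn).le

/-- Idempotent. [folklore] -/
theorem frobEnlargement_idem (φ : Equiv.Perm M) (S : Set M) :
    frobEnlargement φ (frobEnlargement φ S) = frobEnlargement φ S :=
  subset_antisymm (frobEnlargement_minimal φ subset_rfl (image_frobEnlargement φ S))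
    (subset_frobEnlargement φ _)

/-- A map commuting with `φ` and stabilising `S` stabilises the Frobenius enlargement (used for `G_E`-stability of the
pipeline: the Frobenius of `B_E` commutes with `G_E`). [folklore] -/
theorem image_frobEnlargement_of_comm (φ : Equiv.Perm M) {f : M → M} (hf : ∀ m, f (φ m) = φ (f m)) {S : Set M}
    (hS : f '' S = S) : f '' frobEnlargement φ S = frobEnlargement φ S := by
  have hinv : ∀ m, f (φ.symm m) = φ.symm (f m) := fun m =>
    φ.injective (by rw [← hf, Equiv.apply_symm_apply, Equiv.apply_symm_apply])
  have hfn : ∀ n : ℤ, ∀ m, f ((φ ^ n) m) = (φ ^ n) (f m) := by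
    intro n
    induction n using Int.induction_on with
    | zero => intro m; simp
    | succ k ih =>
        intro m
        rw [zpow_add_one, Equiv.Perm.coe_mul, Function.comp_apply, Function.comp_apply, ih, hf]
    | pred k ih =>
        intro m
        rw [zpow_sub_one, Equiv.Perm.coe_mul, Equiv.Perm.coe_inv, Function.comp_apply, Function.comp_apply,
          ih, hinv]
  unfold frobEnlargement
  rw [Set.image_iUnion]
  refine Set.iUnion_congr fun n => ?_
  rw [← Set.image_comp, show f ∘ ⇑(φ ^ n) = ⇑(φ ^ n) ∘ f from funext (hfn n), Set.image_comp, hS]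
end FrobEnlargement

/-! ### §5.3.3 Closed convex hulls in a non-archimedean topological module -/
section Convex
variable (O : Type*) [CommRing O] {M : Type*} [AddCommGroup M] [Module O M]

/-! Non-archimedean convexity is REUSED from slot T-23's landed file (`Summit.ABC.IUTFork.Joshi.LogVol.IsConvexNA`,
[J-III] §9.10.8 citing the same [Schneider, 2002]): `A` is convex iff it is empty or an additive coset `v + A₀` of an
`O`-submodule `A₀` (= of an «absolutely convex» set). The algebraic `LogVol.convexClosure` there has no topology;
§5.3.3 wants the CLOSED convex hull for the Fréchet topology, typed below. -/

/-- `v +ᵥ A₀` is the translate `{v + m | m ∈ A₀}` used in `LogVol.IsConvexNA`. [folklore] -/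
theorem vadd_coe_eq_image (v : M) (A₀ : Submodule O M) :
    v +ᵥ (A₀ : Set M) = (fun m => v + m) '' (A₀ : Set M) := rfl

variable {O} in
/-- A convex set is a coset of a submodule through ANY of its points. [folklore] -/
theorem exists_eq_vadd_of_isConvexNA {A : Set M} (hA : IsConvexNA O A) {s : M} (hs : s ∈ A) :
    ∃ A₀ : Submodule O M, A = s +ᵥ (A₀ : Set M) := by
  rcases hA with rfl | ⟨v, A₀, rfl⟩
  · exact absurd hs (Set.notMem_empty s)
  · refine ⟨A₀, ?_⟩
    obtain ⟨a, ha, rfl⟩ := (Set.mem_image _ _ _).1 hs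
    ext x
    simp only [Set.mem_image, Set.mem_vadd_set, vadd_eq_add, SetLike.mem_coe]
    constructor
    · rintro ⟨b, hb, rfl⟩
      exact ⟨b - a, A₀.sub_mem hb ha, by abel⟩
    · rintro ⟨b, hb, rfl⟩
      exact ⟨a + b, A₀.add_mem ha hb, by abel⟩

variable {O} in
/-- Membership in a coset of a submodule: `x ∈ s + A₀ ↔ x - s ∈ A₀`. [folklore] -/
theorem mem_vadd_coe_iff (s x : M) (A₀ : Submodule O M) : x ∈ s +ᵥ (A₀ : Set M) ↔ x - s ∈ A₀ := by
  rw [Set.mem_vadd_set_iff_neg_vadd_mem, vadd_eq_add, SetLike.mem_coe, neg_add_eq_sub]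

variable [TopologicalSpace M]

/-- [J-III] §5.3.3, p.41 l.35–39: the **closed convex hull** of `S ⊂ B_E` for the Fréchet topology, «the smallest,
closed, convex subset containing `S`» — typed as the intersection of all closed convex supersets (that this
intersection is itself convex is `isConvexNA_closedConvexHull`). [claim: Joshi2024ATS3, status: disputed] -/
def closedConvexHull (S : Set M) : Set M := ⋂₀ {A : Set M | S ⊆ A ∧ IsClosed A ∧ IsConvexNA O A}

/-- `S ⊆ hull S`. [folklore] -/
theorem subset_closedConvexHull (S : Set M) : S ⊆ closedConvexHull O S :=
  Set.subset_sInter fun _ hA => hA.1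

/-- Minimality: every closed convex superset of `S` contains the hull. [folklore] -/
theorem closedConvexHull_minimal {S A : Set M} (hSA : S ⊆ A) (hc : IsClosed A) (hv : IsConvexNA O A) :
    closedConvexHull O S ⊆ A :=
  Set.sInter_subset_of_mem ⟨hSA, hc, hv⟩

/-- T-23's algebraic convex closure (§9.10.8) is contained in the closed convex hull (§5.3.3). [folklore] -/
theorem convexClosure_subset_closedConvexHull (S : Set M) : convexClosure O S ⊆ closedConvexHull O S :=
  Set.sInter_subset_sInter fun _ hA => ⟨hA.2.2, hA.1⟩

/-- The hull is closed. [folklore] -/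
theorem isClosed_closedConvexHull (S : Set M) : IsClosed (closedConvexHull O S) :=
  isClosed_sInter fun _ hA => hA.2.1

/-- The hull of `∅` is `∅`. [folklore] -/
theorem closedConvexHull_empty : closedConvexHull O (∅ : Set M) = ∅ :=
  subset_antisymm (closedConvexHull_minimal O (Set.empty_subset _) isClosed_empty (Or.inl rfl)) (Set.empty_subset _)

/-- **The hull is convex** — an intersection of cosets of submodules through a common point `s ∈ S` is the coset of
the intersection; so «the smallest closed convex subset containing `S`» exists and is `closedConvexHull O S`. [folklore] -/
theorem isConvexNA_closedConvexHull (S : Set M) : IsConvexNA O (closedConvexHull O S) := by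
  rcases S.eq_empty_or_nonempty with rfl | ⟨s, hs⟩
  · rw [closedConvexHull_empty]; exact Or.inl rfl
  · have key : ∀ A : {A : Set M // S ⊆ A ∧ IsClosed A ∧ IsConvexNA O A},
        ∃ A₀ : Submodule O M, (A : Set M) = s +ᵥ (A₀ : Set M) :=
      fun A => exists_eq_vadd_of_isConvexNA A.2.2.2 (A.2.1 hs)
    choose N hN using key
    refine Or.inr ⟨s, ⨅ A, N A, ?_⟩
    rw [← vadd_coe_eq_image]
    ext x
    rw [mem_vadd_coe_iff, Submodule.mem_iInf, closedConvexHull, Set.mem_sInter]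
    constructor
    · intro hx A
      have hxA := hx A A.2
      rwa [hN A, mem_vadd_coe_iff] at hxA
    · intro hx A hA
      have hxA := hx ⟨A, hA⟩
      rw [← mem_vadd_coe_iff] at hxA
      rwa [show A = s +ᵥ ((N ⟨A, hA⟩ : Submodule O M) : Set M) from hN ⟨A, hA⟩]

/-- Monotone. [folklore] -/
theorem closedConvexHull_mono {S T : Set M} (h : S ⊆ T) : closedConvexHull O S ⊆ closedConvexHull O T :=
  closedConvexHull_minimal O (h.trans (subset_closedConvexHull O T)) (isClosed_closedConvexHull O T)
    (isConvexNA_closedConvexHull O T)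

/-- Idempotent. [folklore] -/
theorem closedConvexHull_idem (S : Set M) : closedConvexHull O (closedConvexHull O S) = closedConvexHull O S :=
  subset_antisymm (closedConvexHull_minimal O subset_rfl (isClosed_closedConvexHull O S)
    (isConvexNA_closedConvexHull O S)) (subset_closedConvexHull O _)

/-- One inclusion of functoriality: for an `O`-linear homeomorphism `g`, `hull (g S) ⊆ g (hull S)`. [folklore] -/
theorem closedConvexHull_image_subset (g : M ≃L[O] M) (S : Set M) :
    closedConvexHull O (g '' S) ⊆ g '' closedConvexHull O S :=
  closedConvexHull_minimal O (Set.image_mono (subset_closedConvexHull O S))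
    (g.toHomeomorph.isClosed_image.2 (isClosed_closedConvexHull O S))
    (by simpa using IsConvexNA.image O (g : M →ₗ[O] M) (isConvexNA_closedConvexHull O S))

/-- **The closed convex hull commutes with `O`-linear homeomorphisms**: `g (hull S) = hull (g S)`. [folklore] -/
theorem image_closedConvexHull (g : M ≃L[O] M) (S : Set M) :
    g '' closedConvexHull O S = closedConvexHull O (g '' S) := by
  refine subset_antisymm ?_ (closedConvexHull_image_subset O g S)
  have h := closedConvexHull_image_subset O g.symm (g '' S)
  rw [ContinuousLinearEquiv.symm_image_image] at h
  simpa only [ContinuousLinearEquiv.image_symm_image] using Set.image_mono (f := ⇑g) h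

/-- Hence a map of that kind stabilising `S` stabilises its closed convex hull. [folklore] -/
theorem image_closedConvexHull_of_stable (g : M ≃L[O] M) {S : Set M} (hS : g '' S = S) :
    g '' closedConvexHull O S = closedConvexHull O S := by
  rw [image_closedConvexHull, hS]

/-- [J-III] Rmk. 5.3.3.1, p.41 l.40–p.42 l.1 («enlargements … do not affect lower bounds on the supremum of norms of
elements of `S`»): a lower bound for `sup_{x ∈ S} f x` survives `S ⊆ T`. [folklore] -/
theorem lowerBound_biSup_mono {ι α : Type*} [CompleteLattice α] (f : ι → α) {S T : Set ι} (h : S ⊆ T) {c : α}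
    (hc : c ≤ ⨆ x ∈ S, f x) : c ≤ ⨆ x ∈ T, f x :=
  hc.trans (biSup_mono h)
end Convex

/-! ### The composite of §5.3 (p.41 l.35–36; use site §6.7, slot T-11) -/
section Pipeline
variable (O : Type*) [CommRing O] (G : Type*) [Group G] {M : Type*} [AddCommGroup M] [Module O M]
  [TopologicalSpace M] [MulAction G M]

/-- [J-III] §5.3.3 p.41 l.35–36 «replace such a Galois and Frobenius enlarged set `S` by the closure of its convex
hull»: the full enlargement `hull(⋃ₙ φⁿ(⋃_σ S^σ))` (reading R1 for the first stage). [claim: Joshi2024ATS3, status: disputed] -/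
def fullEnlargement (φ : Equiv.Perm M) (S : Set M) : Set M :=
  closedConvexHull O (frobEnlargement φ (autEnlargement G S))

/-- `S ⊆` its full enlargement. [folklore] -/
theorem subset_fullEnlargement (φ : Equiv.Perm M) (S : Set M) : S ⊆ fullEnlargement O G φ S :=
  ((subset_autEnlargement S).trans (subset_frobEnlargement φ _)).trans (subset_closedConvexHull O _)

/-- The full enlargement is `φ`-stable whenever `φ` is (the underlying permutation of) an `O`-linear homeomorphism —
Thm. 6.7.1 (2) of [J-III] for this construction, offered by name to slot T-11. [folklore] -/
theorem image_fullEnlargement (φ : M ≃L[O] M) (S : Set M) :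
    φ '' fullEnlargement O G (φ : M ≃ M) S = fullEnlargement O G (φ : M ≃ M) S := by
  unfold fullEnlargement
  rw [image_closedConvexHull]
  exact congrArg _ (image_frobEnlargement (φ : M ≃ M) _)

/-- The full enlargement is `G`-stable whenever each `g ∈ G` acts as an `O`-linear homeomorphism commuting with `φ` —
Thm. 6.7.1 (1) of [J-III] for this construction, offered by name to slot T-11. [folklore] -/
theorem smul_fullEnlargement (φ : Equiv.Perm M) (L : G → (M ≃L[O] M)) (hL : ∀ (g : G) (m : M), L g m = g • m)
    (hcomm : ∀ (g : G) (m : M), g • φ m = φ (g • m)) (S : Set M) (g : G) :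
    g • fullEnlargement O G φ S = fullEnlargement O G φ S := by
  have hLg : (fun m : M => L g m) = fun m => g • m := funext (hL g)
  have himg : ∀ T : Set M, (L g) '' T = g • T := fun T => by
    rw [← Set.image_smul, ← hLg]
  unfold fullEnlargement
  rw [← himg, image_closedConvexHull]
  congr 1
  rw [himg, ← Set.image_smul]
  exact image_frobEnlargement_of_comm φ (fun m => hcomm g m)
    (by rw [Set.image_smul, smul_autEnlargement])
end Pipeline
end Summit.ABC.IUTFork.Joshi.ATS3
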